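import Summits.ValiantsHypothesis.ValiantsHypothesis.Theorems.TwistedDetRankDirectSumExp
import Summits.ValiantsHypothesis.ValiantsHypothesis.Theorems.FermionizationDimensionSDimPerNotQPDirectSumExpTransfer
import HarnessLib

/-!
# Route TwistedDetRank — the crux `TdrPerSuperlinear` (stmt-ValiantsHypothesis-6286), PROVED

`TdrPerSuperlinear`: `tdr(per_n)/n → ∞` — for every `C` and all large `n`, every representation of
`per_n` as a sum of `r` twisted determinants has `C · n < r`. With the crux `DirectSumExp` now a
theorem (`directSumExp_proof`, Theorems/TwistedDetRankDirectSumExp.lean) the LANDED transfer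
`stub_superpolyOfDirectSumExp` (Theorems/FermionizationDimensionSDimPerNotQPDirectSumExpTransfer.lean:
`DirectSumExp →` "`tdr(per_n) > n^C` eventually", via `TdrBlockMonotone`) gives even a
super-polynomial bound; the crux is its exponent-`2` instance (`C · n ≤ n² < r` for `n ≥ C`).

Honest framing: a lower bound in the restricted model "sums of twisted determinants" (known-strength
mathematics: the Birkhoff-cone product rank of `sgn₃^{⊗m}` plus block monotonicity); the route's crux
`FermionicNormalForm` (stmt-6283) and target stay OPEN, and nothing here is progress on VP ≠ VNP.
-/

set_option linter.dupNamespace false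

namespace Summit.ValiantsHypothesis.ValiantsHypothesis.Theorems.TwistedDetRankTdrPerSuperlinearProof

open Summit.ValiantsHypothesis.ValiantsHypothesis.Theses.TwistedDetRank
open Summit.ValiantsHypothesis.ValiantsHypothesis.Theorems
open Summit.ValiantsHypothesis.ValiantsHypothesis.Theorems.TwistedDetRankDirectSumExpProof

/-- **Crux `TdrPerSuperlinear` (stmt-ValiantsHypothesis-6286), PROVED**: for every `C` there is `n₀`
with `C · n < r` for every representation of `per_n`, `n ≥ n₀`, as a sum of `r` twisted determinants
— from `tdr(per_n) > n²` eventually (`stub_superpolyOfDirectSumExp directSumExp_proof 2`) and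
`C · n ≤ n²` for `n ≥ C`. [folklore] -/
theorem tdrPerSuperlinear_proof : TdrPerSuperlinear := by
  intro C
  obtain ⟨n₀, h⟩ := stub_superpolyOfDirectSumExp directSumExp_proof 2
  refine ⟨max n₀ C, fun n hn r E hE => ?_⟩
  have h1 : n ^ 2 < r := h n ((le_max_left _ _).trans hn) r E hE
  have hC : C ≤ n := (le_max_right _ _).trans hn
  calc C * n ≤ n * n := Nat.mul_le_mul_right n hC
    _ = n ^ 2 := (sq n).symm
    _ < r := h1

end Summit.ValiantsHypothesis.ValiantsHypothesis.Theorems.TwistedDetRankTdrPerSuperlinearProof
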